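import Literature.Algebra.Homology.GroupCohomologyFiniteIndexModuleFinite
import HarnessLib

/-!
# Finitely generated cohomology of poly-(infinite cyclic) groups and their finite extensions

Topic `Algebra/Homology`; namespace `Literature.Algebra.Homology`.  Theorems only (no definition,
no named fact, no instance, no `sorry`); Mathlib + `InfiniteCyclicQuotientCohomology` (the Wang
sequence of an infinite cyclic quotient) + `GroupCohomologyFiniteIndexModuleFinite` (finite-index
ascent / descent / transport).

Say a group `Γ` has PROPERTY (FC) over the Noetherian ring `k` if `Hⁿ(Γ, A)` is a finitely
generated `k`-module for every representation `A` of `Γ` finitely generated over `k` and every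
`n` (spelled out as a hypothesis / conclusion; no definition is introduced).  Then:

* `moduleFinite_groupCohomology_of_subsingleton` — the trivial group has (FC);
* `moduleFinite_groupCohomology_of_infiniteCyclicQuotient` — if `H ⊴ G` has (FC) and `G / H` is
  infinite cyclic (every `g` is `h tⁿ`, and `tⁿ ∈ H` only for `n = 0`) then `G` has (FC)
  (`moduleFinite_groupCohomology_succ`, the Wang sequence);
* `moduleFinite_groupCohomology_of_chain` — **poly-ℤ induction**: for a chain of subgroups
  `c 0 ≤ c 1 ≤ ⋯ ≤ c m` of a group `G` with `c 0` having (FC), each `c i` normal in `c (i+1)`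
  with infinite cyclic quotient generated by some `t_i ∈ c (i+1)`, the group `c m` has (FC);
* `moduleFinite_groupCohomology_of_chain_of_finiteIndex` — the same followed by a finite-index
  ascent (`moduleFinite_groupCohomology_of_finiteIndex`): every subgroup `Γ ≥ c m` in which `c m`
  has finite index has (FC) — poly-ℤ-by-finite groups, e.g. the arithmetic subgroups
  `{(a b; 0 e)} ≅ 𝔞 ⋊ (units)` of a Borel subgroup over a number field, have finitely generated
  cohomology with finitely generated coefficients [Brown1982CohomologyGroups, VIII §2 and (5.1)],
  [Serre1971CohomologieGroupesDiscrets, §1.8].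

## References

* K. S. Brown, *Cohomology of Groups*, GTM 87 (1982), VIII §2, VIII (5.1)
  [Brown1982CohomologyGroups].
* J.-P. Serre, *Cohomologie des groupes discrets*, Ann. of Math. Studies 70 (1971), §1.8
  [Serre1971CohomologieGroupesDiscrets].
-/

noncomputable section

open CategoryTheory

universe u

namespace Literature.Algebra.Homology

variable {k : Type u} [CommRing k]

/-- A zero module is finitely generated (as in `InfiniteCyclicQuotientCohomology`, where the lemma
is private). [folklore] -/
theorem moduleFinite_of_isZero' {X : ModuleCat.{u} k} (h : Limits.IsZero X) : Module.Finite k X := by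
  have : Subsingleton X := ⟨fun a b => by
    have hab : (𝟙 X : X ⟶ X).hom a = (𝟙 X : X ⟶ X).hom b := by
      rw [h.eq_of_src (𝟙 X) 0]; rfl
    exact hab⟩
  infer_instance

variable [IsNoetherianRing k]

/-- **The trivial group has (FC)**: `H⁰(1, A) = A` and `Hⁿ⁺¹(1, A) = 0`. [folklore] -/
theorem moduleFinite_groupCohomology_of_subsingleton {G : Type u} [Group G] [Subsingleton G]
    (A : Rep k G) [Module.Finite k A] (n : ℕ) : Module.Finite k (groupCohomology A n) := by
  rcases n with _ | n
  · exact moduleFinite_groupCohomology_zero A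
  · exact moduleFinite_of_isZero' (isZero_groupCohomology_succ_of_subsingleton A n)

/-- **(FC) ascends along an infinite cyclic quotient** (the Wang sequence
`Hⁿ(H, A) → Hⁿ⁺¹(G, A) → Hⁿ⁺¹(H, A)`): if `H ⊴ G` has (FC) and `G / H` is infinite cyclic,
generated by `t H`, then `G` has (FC). [cite: Brown1982CohomologyGroups, VIII §2] -/
theorem moduleFinite_groupCohomology_of_infiniteCyclicQuotient {G : Type u} [Group G]
    (H : Subgroup G) [H.Normal] (t : G) (hgen : ∀ g : G, ∃ (h : H) (n : ℤ), g = (h : G) * t ^ n)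
    (hfree : ∀ n : ℤ, t ^ n ∈ H → n = 0)
    (hH : ∀ (B : Rep k H), Module.Finite k B → ∀ n, Module.Finite k (groupCohomology B n))
    (A : Rep k G) [Module.Finite k A] (n : ℕ) : Module.Finite k (groupCohomology A n) := by
  rcases n with _ | n
  · exact moduleFinite_groupCohomology_zero A
  · have hres : Module.Finite k (Rep.res H.subtype A) := ‹Module.Finite k A›
    exact moduleFinite_groupCohomology_succ H A t hgen hfree n (hH _ hres n) (hH _ hres (n + 1))

/-- **Poly-ℤ induction.**  Let `c : ℕ → Subgroup G` with `c 0` having (FC) and, for every `i < m`,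
`c i ≤ c (i + 1)`, `c i` normal in `c (i + 1)`, and `c (i + 1) / c i` infinite cyclic generated by
some `t ∈ c (i + 1)` (every element of `c (i + 1)` is `h tⁿ` with `h ∈ c i`, and `tⁿ ∈ c i` only
for `n = 0`).  Then `c m` has (FC): `Hⁿ(c m, A)` is finitely generated for every finitely generated
`A` and every `n`. [cite: Brown1982CohomologyGroups, VIII §2] -/
theorem moduleFinite_groupCohomology_of_chain {G : Type u} [Group G] (c : ℕ → Subgroup G)
    (h0 : ∀ (B : Rep k (c 0)), Module.Finite k B → ∀ n, Module.Finite k (groupCohomology B n)) :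
    ∀ (m : ℕ),
      (∀ i < m, c i ≤ c (i + 1)) →
      (∀ i < m, ((c i).subgroupOf (c (i + 1))).Normal) →
      (∀ i < m, ∃ t ∈ c (i + 1),
        (∀ g ∈ c (i + 1), ∃ h ∈ c i, ∃ n : ℤ, g = h * t ^ n) ∧ (∀ n : ℤ, t ^ n ∈ c i → n = 0)) →
      ∀ (A : Rep k (c m)), Module.Finite k A → ∀ n, Module.Finite k (groupCohomology A n)
  | 0, _, _, _ => h0
  | m + 1, hle, hnorm, hcyc => by
    -- the induction hypothesis for `c m`, transported to `c m` viewed inside `c (m + 1)`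
    have ih := moduleFinite_groupCohomology_of_chain c h0 m (fun i hi => hle i (Nat.lt_succ_of_lt hi))
      (fun i hi => hnorm i (Nat.lt_succ_of_lt hi)) (fun i hi => hcyc i (Nat.lt_succ_of_lt hi))
    have hle' : c m ≤ c (m + 1) := hle m (Nat.lt_succ_self m)
    haveI hN : ((c m).subgroupOf (c (m + 1))).Normal := hnorm m (Nat.lt_succ_self m)
    obtain ⟨t, ht, hgen, hfree⟩ := hcyc m (Nat.lt_succ_self m)
    have ih' : ∀ (B : Rep k ((c m).subgroupOf (c (m + 1)))), Module.Finite k B → ∀ n,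
        Module.Finite k (groupCohomology B n) := fun B hB n => by
      haveI := hB
      exact moduleFinite_groupCohomology_of_mulEquiv (Subgroup.subgroupOfEquivOfLe hle').symm ih B n
    intro A hA n
    haveI := hA
    refine moduleFinite_groupCohomology_of_infiniteCyclicQuotient ((c m).subgroupOf (c (m + 1)))
      ⟨t, ht⟩ (fun g => ?_) (fun n hn => ?_) ih' A n
    · obtain ⟨h, hh, n, hg⟩ := hgen g g.2
      refine ⟨⟨⟨h, hle' hh⟩, Subgroup.mem_subgroupOf.2 hh⟩, n, Subtype.ext ?_⟩
      rw [Subgroup.coe_mul, SubgroupClass.coe_zpow]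
      exact hg
    · exact hfree n (by simpa [Subgroup.mem_subgroupOf] using hn)

/-- **Poly-ℤ-by-finite groups have finitely generated cohomology with finitely generated
coefficients**: with `c` as in `moduleFinite_groupCohomology_of_chain`, every subgroup `Γ` of `G`
containing `c m` with finite index has (FC) (finite-index ascent,
`moduleFinite_groupCohomology_of_finiteIndex`). [cite: Brown1982CohomologyGroups, VIII §2 and (5.1)]
[cite: Serre1971CohomologieGroupesDiscrets, §1.8] -/
theorem moduleFinite_groupCohomology_of_chain_of_finiteIndex {G : Type u} [Group G]
    (c : ℕ → Subgroup G)
    (h0 : ∀ (B : Rep k (c 0)), Module.Finite k B → ∀ n, Module.Finite k (groupCohomology B n))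
    (m : ℕ) (hle : ∀ i < m, c i ≤ c (i + 1))
    (hnorm : ∀ i < m, ((c i).subgroupOf (c (i + 1))).Normal)
    (hcyc : ∀ i < m, ∃ t ∈ c (i + 1),
      (∀ g ∈ c (i + 1), ∃ h ∈ c i, ∃ n : ℤ, g = h * t ^ n) ∧ (∀ n : ℤ, t ^ n ∈ c i → n = 0))
    (Γ : Subgroup G) (hΓ : c m ≤ Γ) [((c m).subgroupOf Γ).FiniteIndex]
    (A : Rep k Γ) [Module.Finite k A] (n : ℕ) : Module.Finite k (groupCohomology A n) := by
  have hm := moduleFinite_groupCohomology_of_chain c h0 m hle hnorm hcyc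
  have hm' : ∀ (B : Rep k ((c m).subgroupOf Γ)), Module.Finite k B → ∀ n,
      Module.Finite k (groupCohomology B n) := fun B hB n => by
    haveI := hB
    exact moduleFinite_groupCohomology_of_mulEquiv (Subgroup.subgroupOfEquivOfLe hΓ).symm hm B n
  exact moduleFinite_groupCohomology_of_finiteIndex _ hm' n A ‹Module.Finite k A›

end Literature.Algebra.Homology

end
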